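import Summits.BirchSwinnertonDyer.BirchSwinnertonDyer.Theorems.EisensteinPrimesCharLocalLemmas
import HarnessLib

/-!
# The local factor of `H¹_{𝓕_nr^{S}}/H¹_{𝓕_nr}` for a CHARACTER module `(F/𝒪)(θ)` VANISHES at a place
# `w ∤ p` where `θ` is unramified with `θ(Frob_w) ≢ Nw (mod p)` (Keller–Yin / CGLS Lemma 1.1.1,
# Greenberg–Vatsal Prop. (2.4): the case `λ(𝒫_w(θ)) = 0`, unramified half) — KERNEL, part 2

Cell `bsd-eis`, seat `bsd-line-x1-p1` (LEAD, D-0154 row 4), crux 2 `GoodLatticeBDPValue`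
(stmt-BirchSwinnertonDyer-19032), line `halves` v14, stub `stub_imprimCorank` (`≤` half of the
`S`-relaxation corank identity `prop125_residualPair_unrSelmer_corank`). Tool theorems only (no
definition, no named fact, no `sorry`). Sequel of `EisensteinPrimesCharLocalLemmas` (ramified case and
the local Frobenius lemmas).

* **`resH1Hom_inertiaIn_eq_zero_of_frob_ne_norm`** — for `w ∤ p`, `I_w ≤ H`, `H` containing the
  restriction of every element of `Γ_{K_w}` killed by all continuous `Γ_{K_w} → ℤ_p` (e.g. `H = ker κ`),
  `θ(I_{K_w}) = 1` and `θ(Frob_w) - Nw` a unit of `ℤ_p` (`θ(Frob_w) ≢ Nw (mod p)`): every class of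
  `H¹(H, (F/𝒪)(θ))` whose restriction to `H ∩ I_w` is `p`-torsion restricts to ZERO.
  Proof (Greenberg–Vatsal p. 22 "Frob_ℓ acts on `A(-1)`" / Serre 1972 §1.8): inflate to `absInertia K_w`;
  the restricted cocycle is a continuous homomorphism `f : I_{K_w} → A[p]`; conjugation by the
  prime-to-`p` part `g` of the Frobenius multiplies it by `q` (`apply_conj_eq_nsmul_of_mapClusterPt`);
  `g` restricts into `H`, where the cocycle identity gives `f(gσg⁻¹) = θ(g) f(σ)`; so `(θ(g) − q) f = 0`
  with `θ(g) − q` a unit (`isUnit_sub_of_mapClusterPt`), i.e. `f = 0`.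
* `zpCorank_eq_zero_of_frob_ne_norm` — hence (`H = ker κ`) every subgroup of the image of
  `H¹(K_∞, (F/𝒪)(θ)) → H¹(inertiaIn (ker κ) w, (F/𝒪)(θ))` has `zpCorank = 0`: the per-place bound
  `c_w = 0` of `DatumSelmerQuotientCorankGeneric.zpCorank_quotient_le_sum` at such `w`.

References: [GreenbergVatsal2000] §2 Prop. (2.4) pp. 22–23; [KellerYin2024] Lemma 1.1.1 (arXiv:2402.12781v2
TeX L455–462); [CastellaGrossiLeeSkinner2022] Lemma 1.1.1; [SerreInventiones1972] §1.8 Prop. 6.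
-/

set_option linter.dupNamespace false
set_option autoImplicit false

noncomputable section

open scoped Classical NNReal AddSubgroup

open CategoryTheory Function Filter NumberField IsDedekindDomain Field ValuativeRel
open Literature.NumberTheory.EllipticCurves Literature.NumberTheory.EllipticCurves.GreenbergSelmer
  Literature.NumberTheory.GaloisRepresentations
  Literature.NumberTheory.GaloisRepresentations.IsNonarchimedeanLocalField
  Literature.NumberTheory.EllipticCurves.KellerYin2024 Literature.NumberTheory.IwasawaTheory
  IsDedekindDomain.HeightOneSpectrum
open Summit.BirchSwinnertonDyer.Rank1Residual
  Summit.BirchSwinnertonDyer.Rank1Residual.X2.NonPrimitiveQuotientCorank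
  Summit.BirchSwinnertonDyer.BirchSwinnertonDyer.Theorems.IwasawaTwoVariable
  Summit.BirchSwinnertonDyer.BirchSwinnertonDyer.Theorems.UnrSelmerQuotientTorsionFiniteChar
  Summit.BirchSwinnertonDyer.BirchSwinnertonDyer.Theorems.InertiaTorsionCardGeneric

namespace Summit.BirchSwinnertonDyer.BirchSwinnertonDyer.Theorems.CharLocalVanishing

variable {K : Type} [Field K] [NumberField K] {p : ℕ} [hp : Fact p.Prime]
  (θ : FramedGaloisRep K (padicCoeffIntegers (∅ : Set (PadicAlgCl p))) 1)
  {v : HeightOneSpectrum (𝓞 K)}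

section Frobenius

variable (H : Subgroup (absoluteGaloisGroup K))

set_option maxHeartbeats 800000 in
-- the cocycle bookkeeping on `H¹(H, (F/𝒪)(θ))` (quotient-module coefficients) is defeq-heavy
/-- **Unramified, non-anomalous at `w`: `p`-torsion restricted classes VANISH.** Let `w ∤ p`, `I_w ≤ H`,
and let `H` contain the restriction of every element of `Γ_{K_w}` killed by all continuous
`Γ_{K_w} → ℤ_p` (e.g. `H = Gal(K̄/K_∞)` for a `ℤ_p`-extension). Let `θ : Γ_K → GL₁(𝓞)` be trivial on
the local inertia group `I_{K_w}` and let `θ(φ) - Nw` be a UNIT of `ℤ_p` for an arithmetic Frobenius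
`φ` of `K_w` (`θ(Frob_w) ≢ Nw (mod p)`, i.e. NOT `FrobActsAsNormAt`). Then every class of
`H¹(H, (F/𝒪)(θ))` whose restriction to `H ∩ I_w` is `p`-torsion restricts to ZERO. (Inflate to
`absInertia K_w`; the restricted cocycle is a continuous homomorphism `f : I_{K_w} → A[p]`; Frobenius
conjugation multiplies it by `q = Nw` (Serre 1972 §1.8, tree `apply_frob_conj_eq_card_nsmul`), hence so
does the prime-to-`p` part `g` of `φ` (a cluster point of `φ^{p^{k!}}`; `q^{p^{k!}} ≡ q`), which restricts
into `H` where the cocycle identity reads `f(gσg⁻¹) = θ(g) f(σ)`; so `(θ(g) - q) f = 0` with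
`θ(g) ≡ θ(φ)`.) Greenberg–Vatsal Prop. (2.4) (inertia side, `d = 0`) / KY Lemma 1.1.1 for an unramified
character with `θ(Frob_w) ≢ Nw`. [cite: GreenbergVatsal2000, §2 Prop. (2.4) pp. 22–23]
[cite: KellerYin2024, Lemma 1.1.1 (arXiv:2402.12781v2 TeX L455–462)] [cite: SerreInventiones1972, §1.8 Prop. 6] -/
theorem resH1Hom_inertiaIn_eq_zero_of_frob_ne_norm (hIH : inertia (K := K) v ≤ H)
    (hH : ∀ g : absoluteGaloisGroup (v.adicCompletion K),
      (∀ χ : absoluteGaloisGroup (v.adicCompletion K) →ₜ* Multiplicative ℤ_[p], χ g = 1) →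
      absGaloisRestrict K (v.adicCompletion K) g ∈ H)
    (hpv : (p : 𝓞 K) ∉ v.asIdeal)
    (hunr : ∀ σ : absoluteGaloisGroup (v.adicCompletion K), σ ∈ absInertia (v.adicCompletion K) →
      unitChar θ (absGaloisRestrict K (v.adicCompletion K) σ) = 1)
    {φ : absoluteGaloisGroup (v.adicCompletion K)} (hφ : IsAbsArithFrob φ)
    (hne : IsUnit (((unitChar θ (absGaloisRestrict K (v.adicCompletion K) φ) : ℤ_[p]ˣ) : ℤ_[p]) -
      (residueFieldCard (v.adicCompletion K) : ℤ_[p])))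
    (c : subgroupH1 H (charModule (∅ : Set (PadicAlgCl p)) θ))
    (hpc : p • resH1Hom (inertiaInToH H v) (AddMonoidHom.id (charModule (∅ : Set (PadicAlgCl p)) θ))
      (fun _ _ ↦ rfl) c = 0) :
    resH1Hom (inertiaInToH H v) (AddMonoidHom.id (charModule (∅ : Set (PadicAlgCl p)) θ))
      (fun _ _ ↦ rfl) c = 0 := by
  haveI : CompactSpace (absoluteGaloisGroup (v.adicCompletion K)) :=
    absoluteGaloisGroup_compactSpace (v.adicCompletion K)
  haveI := finite_torsionBy_charModule (p := p) θ
  set A := charModule (∅ : Set (PadicAlgCl p)) θ with hA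
  -- the surjection `θI : absInertia K_v ↠ H ∩ I_v` and the injectivity of inflation along it
  let θI : absInertia (v.adicCompletion K) →ₜ* inertiaIn H v :=
    { toFun := fun σ ↦ ⟨⟨absGaloisRestrict K (v.adicCompletion K) σ, ⟨σ, rfl⟩⟩,
        (mem_inertiaIn_iff H v _).2
          ⟨hIH (Subgroup.mem_map_of_mem _ σ.2), Subgroup.mem_map_of_mem _ σ.2⟩⟩
      map_one' := Subtype.ext (Subtype.ext (by simp))
      map_mul' := fun x y ↦ Subtype.ext (Subtype.ext (by simp))
      continuous_toFun := by
        refine Continuous.subtype_mk (Continuous.subtype_mk ?_ _) _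
        exact (absGaloisRestrict K (v.adicCompletion K)).continuous_toFun.comp continuous_subtype_val }
  have hθI : Function.Surjective θI := by
    intro x
    obtain ⟨σ, hσ, hσx⟩ := Subgroup.mem_map.1 ((mem_inertiaIn_iff H v x.1).1 x.2).2
    exact ⟨⟨σ, hσ⟩, Subtype.ext (Subtype.ext hσx)⟩
  have hinj := map_one_injective_of_surjective (discreteTopRep (inertiaIn H v) A) θI hθI
  -- the prime-to-`p` part `g` of `φ`; its restriction lies in `H`
  obtain ⟨g, hg⟩ := exists_mapClusterPt_pow_prime_pow_factorial φ p
  have hgH : absGaloisRestrict K (v.adicCompletion K) g ∈ H :=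
    hH g fun χ ↦ map_eq_one_of_mapClusterPt χ hg
  -- a cocycle of `c`, its restriction to `H ∩ I_v`, and the inflation to `absInertia K_v`
  obtain ⟨F, rfl⟩ := oneCocycleClass_surjective _ c
  rw [resH1Hom_oneCocycleClass] at hpc ⊢
  set F' := contOneCocycles.pullback (inertiaInToH H v)
    (resHomOfEquivariant (inertiaInToH H v) (AddMonoidHom.id A) (fun _ _ ↦ rfl)) F with hF'
  set f := contOneCocycles.pullback θI
    (𝟙 (TopRep.res (θI : absInertia (v.adicCompletion K) →* inertiaIn H v)
      (discreteTopRep (inertiaIn H v) A))) F' with hf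
  suffices hf0 : oneCocycleClass (TopRep.res (θI : absInertia (v.adicCompletion K) →* inertiaIn H v)
      (discreteTopRep (inertiaIn H v) A)) f = 0 by
    apply hinj
    rw [map_oneCocycleClass, map_zero]
    exact hf0
  have hfval : ∀ σ : absInertia (v.adicCompletion K),
      f.1 σ = F.1 ⟨absGaloisRestrict K (v.adicCompletion K) σ,
        hIH (Subgroup.mem_map_of_mem _ σ.2)⟩ := fun σ ↦ rfl
  -- `p • [f] = 0`
  have hpf : p • oneCocycleClass (TopRep.res (θI : absInertia (v.adicCompletion K) →* inertiaIn H v)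
      (discreteTopRep (inertiaIn H v) A)) f = 0 := by
    have h0 := congrArg (ContinuousCohomology.map θI
      (𝟙 (TopRep.res (θI : absInertia (v.adicCompletion K) →* inertiaIn H v)
        (discreteTopRep (inertiaIn H v) A))) 1) hpc
    rw [map_nsmul, map_zero, map_oneCocycleClass] at h0
    exact h0
  -- the local inertia group acts trivially on `A`
  have htriv : ∀ (σ : absInertia (v.adicCompletion K)) (a : A),
      absGaloisRestrict K (v.adicCompletion K) (σ : absoluteGaloisGroup (v.adicCompletion K)) • a = a :=
    fun σ a ↦ smul_eq_self_of_unitChar_eq_one θ (hunr σ σ.2) a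
  -- hence `p • f σ = 0` pointwise (coboundaries of `absInertia K_v` vanish)
  have hpval : ∀ σ : absInertia (v.adicCompletion K), p • f.1 σ = 0 := by
    have h := oneCocycleClass_smul (TopRep.res (θI : absInertia (v.adicCompletion K) →* inertiaIn H v)
      (discreteTopRep (inertiaIn H v) A)) (p : ℤ) f
    conv at h => rhs; rw [Nat.cast_smul_eq_nsmul, hpf]
    rw [oneCocycleClass_eq_zero_iff] at h
    obtain ⟨a, ha⟩ := h
    intro σ
    have h1 := ha σ
    change (p : ℤ) • f.1 σ =
      absGaloisRestrict K (v.adicCompletion K) (σ : absoluteGaloisGroup (v.adicCompletion K)) • a - a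
      at h1
    rw [htriv, sub_self] at h1
    simpa only [Nat.cast_smul_eq_nsmul, natCast_zsmul] using h1
  -- `f` as a continuous homomorphism into the finite group `A[p]`
  let fB : absInertia (v.adicCompletion K) → ↥(A[(p : ℤ)]) := fun σ ↦
    ⟨f.1 σ, AddSubgroup.torsionBy.nsmul_iff.mpr (hpval σ)⟩
  have hfBval : ∀ σ, ((fB σ : ↥(A[(p : ℤ)])) : A) = f.1 σ := fun _ ↦ rfl
  have hfB_mul : ∀ x y, fB (x * y) = fB x + fB y := fun x y ↦ by
    apply Subtype.ext
    change f.1 (x * y) = f.1 x + f.1 y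
    rw [f.2 x y]
    congr 1
    exact htriv x (f.1 y)
  have hfB_cont : Continuous fB := f.1.continuous.subtype_mk _
  have hℓ := ringChar_residueField_prime (F := v.adicCompletion K)
  have hneℓ := v.ringChar_residueField_adicCompletion_ne hpv
  -- Serre + cluster point: conjugation by `g` multiplies `fB` by `q`
  let conjI : absoluteGaloisGroup (v.adicCompletion K) → absInertia (v.adicCompletion K) →
      absInertia (v.adicCompletion K) := fun x σ ↦
    ⟨x * σ * x⁻¹, (inferInstance : (absInertia (v.adicCompletion K)).Normal).conj_mem _ σ.2 x⟩
  have hconjg : ∀ σ, fB (conjI g σ) = residueFieldCard (v.adicCompletion K) • fB σ := fun σ ↦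
    apply_conj_eq_nsmul_of_mapClusterPt (p := p) (v.adicCompletion K) (by
      rw [natCard_torsionBy_charModule]
      exact ((Nat.coprime_primes hp.out hℓ).2 (Ne.symm hneℓ)))
      (fun b ↦ Subtype.ext (by
        rw [AddSubmonoidClass.coe_nsmul, ZeroMemClass.coe_zero]
        exact AddSubgroup.torsionBy.nsmul_iff.mp b.2))
      fB hfB_mul hfB_cont hφ hg σ
  -- the cocycle identity on `H`: `F(G S G⁻¹) = G • F(S)` when `S` acts trivially on `A`
  have hcocH : ∀ (G S : H), (∀ a : A, ((S : H) : absoluteGaloisGroup K) • a = a) →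
      F.1 (G * S * G⁻¹) = ((G : H) : absoluteGaloisGroup K) • F.1 S := by
    intro G S hS
    have h1 : F.1 (G * S * G⁻¹) =
        F.1 (G * S) + ((G * S : H) : absoluteGaloisGroup K) • F.1 G⁻¹ := F.2 _ _
    have h2 : F.1 (G * S) = F.1 G + ((G : H) : absoluteGaloisGroup K) • F.1 S := F.2 _ _
    have h3 : F.1 (G * G⁻¹) = F.1 G + ((G : H) : absoluteGaloisGroup K) • F.1 G⁻¹ := F.2 _ _
    have h00 : F.1 (1 * 1) = F.1 1 + ((1 : H) : absoluteGaloisGroup K) • F.1 1 := F.2 _ _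
    rw [mul_one, OneMemClass.coe_one, one_smul, left_eq_add] at h00
    rw [mul_inv_cancel, h00] at h3
    have h4 : ((G : H) : absoluteGaloisGroup K) • F.1 G⁻¹ = -F.1 G :=
      eq_neg_of_add_eq_zero_right h3.symm
    have hσtriv : ((G * S : H) : absoluteGaloisGroup K) • F.1 G⁻¹ =
        ((G : H) : absoluteGaloisGroup K) • F.1 G⁻¹ := by
      rw [Subgroup.coe_mul, mul_smul]
      congr 1
      exact hS (F.1 G⁻¹)
    rw [h1, h2, hσtriv, h4]
    abel
  -- the elements `res g`, `res σ` of `H`, and `f(gσg⁻¹) = F(res g · res σ · (res g)⁻¹)`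
  let Gg : H := ⟨absGaloisRestrict K (v.adicCompletion K) g, hgH⟩
  let Sg : absInertia (v.adicCompletion K) → H := fun σ ↦
    ⟨absGaloisRestrict K (v.adicCompletion K) σ, hIH (Subgroup.mem_map_of_mem _ σ.2)⟩
  have hval : ∀ σ : absInertia (v.adicCompletion K), f.1 (conjI g σ) = F.1 (Gg * Sg σ * Gg⁻¹) := by
    intro σ
    rw [hfval]
    congr 1
    refine Subtype.ext ?_
    change absGaloisRestrict K (v.adicCompletion K)
        (g * (σ : absoluteGaloisGroup (v.adicCompletion K)) * g⁻¹) =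
      absGaloisRestrict K (v.adicCompletion K) g *
        absGaloisRestrict K (v.adicCompletion K) (σ : absoluteGaloisGroup (v.adicCompletion K)) *
        (absGaloisRestrict K (v.adicCompletion K) g)⁻¹
    rw [map_mul, map_mul, map_inv]
  -- `θ(g) - q` is a unit: `θ(g) ≡ θ(φ) (mod p)` since `g` is a cluster point of `φ^{p^{k!}}`
  have hug : IsUnit (((unitChar θ (absGaloisRestrict K (v.adicCompletion K) g) : ℤ_[p]ˣ) : ℤ_[p]) -
      (residueFieldCard (v.adicCompletion K) : ℤ_[p])) := by
    refine isUnit_sub_of_mapClusterPt (p := p) (v.adicCompletion K)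
      (fun x ↦ ((unitChar θ (absGaloisRestrict K (v.adicCompletion K) x) : ℤ_[p]ˣ) : ℤ_[p]))
      (Units.continuous_val.comp ((unitChar θ).continuous_toFun.comp
        (absGaloisRestrict K (v.adicCompletion K)).continuous_toFun)) (fun n ↦ ?_) hg hne
    rw [map_pow, map_pow, Units.val_pow_eq_pow_val]
  -- conclusion: `f σ = 0` for every `σ`
  have hzero : ∀ σ : absInertia (v.adicCompletion K), f.1 σ = 0 := by
    intro σ
    have e1 : ((fB (conjI g σ) : ↥(A[(p : ℤ)])) : A) =
        residueFieldCard (v.adicCompletion K) • f.1 σ :=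
      (congrArg Subtype.val (hconjg σ)).trans (AddSubmonoidClass.coe_nsmul _ _)
    have e2 : ((fB (conjI g σ) : ↥(A[(p : ℤ)])) : A) =
        absGaloisRestrict K (v.adicCompletion K) g • f.1 σ :=
      calc ((fB (conjI g σ) : ↥(A[(p : ℤ)])) : A) = f.1 (conjI g σ) := rfl
        _ = F.1 (Gg * Sg σ * Gg⁻¹) := hval σ
        _ = ((Gg : H) : absoluteGaloisGroup K) • F.1 (Sg σ) := hcocH Gg (Sg σ) (htriv σ)
        _ = absGaloisRestrict K (v.adicCompletion K) g • f.1 σ := rfl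
    have e4 := congrArg (charModuleEquiv θ) (e2.symm.trans e1)
    rw [charModuleEquiv_galois_smul, map_nsmul, ← Nat.cast_smul_eq_nsmul ℤ_[p]] at e4
    exact (charModuleEquiv θ).map_eq_zero_iff.mp (eq_zero_of_unit_sub_smul_eq hug e4)
  rw [oneCocycleClass_eq_zero_iff]
  exact ⟨0, fun σ ↦ by rw [hzero, map_zero, sub_zero]⟩

/-- **`c_w = 0` at an unramified non-anomalous place**, `H = ker κ` spelling for a `ℤ_p`-extension
`κ` (`I_w ≤ ker κ`; the prime-to-`p` part of a Frobenius is killed by `κ ∘ res`): if `θ(I_{K_w}) = 1`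
and `θ(Frob_w) - Nw` is a unit of `ℤ_p`, EVERY subgroup `Y` of the image of
`H¹(K_∞, (F/𝒪)(θ)) → H¹(inertiaIn (ker κ) w, (F/𝒪)(θ))` has `zpCorank Y p = 0` (its `p`-torsion is
trivial). Greenberg–Vatsal Prop. (2.4) / KY Lemma 1.1.1: `λ(𝒫_w(θ)) = 0` when `θ(Frob_w) ≢ ℓ`.
[cite: GreenbergVatsal2000, §2 Prop. (2.4) pp. 22–23] [cite: KellerYin2024, Lemma 1.1.1 (arXiv:2402.12781v2 TeX L455–462)] -/
theorem zpCorank_eq_zero_of_frob_ne_norm (κ : ZpExtension K p) (hpv : (p : 𝓞 K) ∉ v.asIdeal)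
    (hunr : ∀ σ : absoluteGaloisGroup (v.adicCompletion K), σ ∈ absInertia (v.adicCompletion K) →
      unitChar θ (absGaloisRestrict K (v.adicCompletion K) σ) = 1)
    {φ : absoluteGaloisGroup (v.adicCompletion K)} (hφ : IsAbsArithFrob φ)
    (hne : IsUnit (((unitChar θ (absGaloisRestrict K (v.adicCompletion K) φ) : ℤ_[p]ˣ) : ℤ_[p]) -
      (residueFieldCard (v.adicCompletion K) : ℤ_[p])))
    (Y : AddSubgroup (discreteH1 (inertiaIn κ.kerSubgroup v) (charModule (∅ : Set (PadicAlgCl p)) θ)))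
    (hY : ∀ y ∈ Y, ∃ x : subgroupH1 κ.kerSubgroup (charModule (∅ : Set (PadicAlgCl p)) θ),
      resH1Hom (inertiaInToH κ.kerSubgroup v) (AddMonoidHom.id _) (fun _ _ ↦ rfl) x = y) :
    zpCorank Y p = 0 := by
  refine zpCorank_eq_zero_of_torsionBy_trivial fun y hy ↦ ?_
  obtain ⟨x, hx⟩ := hY y.1 y.2
  have hpy : p • resH1Hom (inertiaInToH κ.kerSubgroup v)
      (AddMonoidHom.id (charModule (∅ : Set (PadicAlgCl p)) θ)) (fun _ _ ↦ rfl) x = 0 := by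
    rw [hx, ← AddSubmonoidClass.coe_nsmul, hy, ZeroMemClass.coe_zero]
  have h0 := resH1Hom_inertiaIn_eq_zero_of_frob_ne_norm θ κ.kerSubgroup
    (Iwasawa.inertia_le_kerSubgroup' κ v hpv)
    (fun _ hg ↦ ZpExtension.mem_kerSubgroup.mpr
      (hg (κ.toContinuousMonoidHom.comp (absGaloisRestrict K (v.adicCompletion K)))))
    hpv hunr hφ hne x hpy
  exact Subtype.ext (by rw [← hx, h0, ZeroMemClass.coe_zero])

end Frobenius

end Summit.BirchSwinnertonDyer.BirchSwinnertonDyer.Theorems.CharLocalVanishing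

end
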